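import Mathlib
import Summits.Ventures.HodgeRepro.Tier4.Common.AdelicDefs
import Summits.Ventures.HodgeRepro.Tier4.Common.SettingOfData
import Summits.Ventures.HodgeRepro.Tier4.Common.MixedPlane
import Summits.Ventures.HodgeRepro.Tier4.Common.MixedPlaneKType
import Summits.Ventures.HodgeRepro.Tier4.Common.RowPlane
import Summits.Ventures.HodgeRepro.Tier4.Common.RowTorus
import Summits.Ventures.HodgeRepro.Tier4.Line1.RTFSetting
import Summits.Ventures.HodgeRepro.Tier4.Line4.LevelCosetCongruence
import Summits.Ventures.HodgeRepro.Tier4.Line4.BlockDetCongruence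
import Summits.Ventures.HodgeRepro.Tier4.Line4.LevelKVacuity
import Summits.Ventures.HodgeRepro.Tier4.Line4.OrbitInvariant
import Summits.Ventures.HodgeRepro.Tier4.Line4.RationalLineScalars
import Summits.Ventures.HodgeRepro.Tier4.Line4.RowLineCoords
import Summits.Ventures.HodgeRepro.Tier4.Line4.TransportSelfAdjoint
import Summits.Ventures.HodgeRepro.Tier4.Line4.OrbitFibre
import Summits.Ventures.HodgeRepro.Tier4.Line4.OrbitInvariantBridge

/-!
# Tier4/Line4/OrbitInvariantFibre — THE FIBRE OF `orbitInv` ON THE REGULAR LOCUS HAS ONE ELEMENT (the instantiation of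
L2-p3's OrbitFibre at the orbit invariant; crit-1 S15255 RECORD (2), (S2′)(ii))

Blind re-derivation cell `pub-hodge-repro`, Tier 4 «prove the step» (README §9–§10), seat t4-L1-p3 (gen 4).
Tree path `lean/Summits/Ventures/HodgeRepro/Tier4/Line4/OrbitInvariantFibre.lean`.

On the transported row plane `W = (ofLinesRow q a b ε).withTransportedTorus g g' …` with `q.t = 0` and the similitude
`g B′ gᵀ = λ B` (`B′` the Gram matrix of the source plane `ofLinesRow q a' b' ε'`), L2-p3's
`orbitOf_eq_of_scalar_nrm_eq` is instantiated with the rows `w = ![e₀, e₂]` (spanning the `P`-lines) and `v j = w j g'`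
(spanning the `Q`-lines): the hypotheses `hΩ` (`Ω² = −n`), `hΩB`, `hPB`, `hQB` (`transported_selfAdjoint`), `hw`, `hv`,
`ha0`, `hb` are DISCHARGED from the plane data, the four block scalars of a rational `γ` are read off
`row_coords_block` (`x i j = (m g) (2i) (2j)`, `y i j = (m g) (2i+1) (2j)`), and the `(0,0)` norm is `orbitInvK g m`
(OrbitInvariantBridge).  RESULT: **`orbitOf_eq_of_orbitInv_eq`** — two rational points with all four block scalars
non-zero (`hreg`, `hreg'`; the regular locus) and the same orbit invariant lie in the same `T(k) \ G(k) / T′(k)` orbit;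
contrapositive **`orbitInv_ne_of_orbitOf_ne`**: off the orbit of `γ₀` the invariant differs — the `hne` binder of
OrbitInvariantFinite's read-out with `E = {o₀}` (on the regular locus).
Remaining for the consumer: `hreg` from `IsLinRegular` (L2-p3's (a)), the irregular double cosets (their (b)),
`hd : ¬ IsSquare (−q.n)` (the CM condition `ω ∉ k`), `q.t = 0` (crit-1 S15229: a lemma hypothesis only).
No printed input.  HC_CM is NOT proved by anyone in this repository.
-/

namespace Summit.Ventures.HodgeRepro.Tier4.Line4

open Summit.Ventures.HodgeRepro.Tier4.Common Summit.Ventures.HodgeRepro.Tier4.Line1.RTF NumberField Matrix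
open scoped NumberField

noncomputable section

section Blocks

variable {R : Type} [CommRing R]

/-- The projector `blockDiag4R 0 1`, explicitly. -/
theorem blockDiag4R_zero_one_eq :
    blockDiag4R (0 : Matrix (Fin 2) (Fin 2) R) 1 = !![0, 0, 0, 0; 0, 0, 0, 0; 0, 0, 1, 0; 0, 0, 0, 1] := by
  ext i j
  fin_cases i <;> fin_cases j <;> rfl

/-- The entry relations of a matrix commuting with `ω ⊕ ω`: `M (2i) (2j+1) = −n · M (2i+1) (2j)` for the four blocks. -/
theorem entries_of_comm {t n : R} {M : Matrix (Fin 4) (Fin 4) R}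
    (h : M * blockDiag4R (omegaMatR t n) (omegaMatR t n) = blockDiag4R (omegaMatR t n) (omegaMatR t n) * M) :
    M 0 1 = -(n * M 1 0) ∧ M 0 3 = -(n * M 1 2) ∧ M 2 1 = -(n * M 3 0) ∧ M 2 3 = -(n * M 3 2) := by
  rw [blockDiag4R_omegaMatR_eq] at h
  have h00 := congrFun (congrFun h 0) 0
  have h02 := congrFun (congrFun h 0) 2
  have h20 := congrFun (congrFun h 2) 0
  have h22 := congrFun (congrFun h 2) 2
  simp [Matrix.mul_apply, Fin.sum_univ_four] at h00 h02 h20 h22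
  refine ⟨?_, ?_, ?_, ?_⟩
  · linear_combination h00
  · linear_combination h02
  · linear_combination h20
  · linear_combination h22

end Blocks

section Fibre

variable {k : Type} [Field k] [NumberField k] (q : QuadData k) (a b ε a' b' ε' : k)
  (g g' : Matrix (Fin 4) (Fin 4) k) (hgg' : g * g' = 1) (hg'g : g' * g = 1)
  (hgΩ : g * (PlaneData.ofLinesRow q a b ε).Ω = (PlaneData.ofLinesRow q a b ε).Ω * g)

omit [NumberField k] in
/-- `Ω² = −n` on the row plane with `t = 0`. -/
theorem ofLinesRow_Ω_sq (ht : q.t = 0) :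
    (PlaneData.ofLinesRow q a b ε).Ω * (PlaneData.ofLinesRow q a b ε).Ω =
      -(q.n • (1 : Matrix (Fin 4) (Fin 4) k)) := by
  rw [ofLinesRow_Ω_eq_blockDiag4R, blockDiag4R_omegaMatR_eq, ht]
  ext i j
  fin_cases i <;> fin_cases j <;> simp [Matrix.mul_apply, Fin.sum_univ_four]

omit [NumberField k] in
/-- The Gram matrix of the row plane, explicitly (`t = 0`). -/
theorem ofLinesRow_B_eq (ht : q.t = 0) :
    (PlaneData.ofLinesRow q a b ε).B =
      !![a * (2 * q.n), 0, 0, 0; 0, a * 2, 0, 0; 0, 0, ε * (b * (2 * q.n)), 0; 0, 0, 0, ε * (b * 2)] := by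
  show blockDiag4 (lineGramRow q a) (ε • lineGramRow q b) = _
  ext i j
  fin_cases i <;> fin_cases j <;> simp [blockDiag4, re4, lineGramRow, ht, Matrix.coe_reindexAlgEquiv,
    Matrix.reindex_apply, Matrix.submatrix_apply, Matrix.fromBlocks] <;> rfl

omit [NumberField k] in
include hgg' hg'g in
/-- The transported projectors are `B`-self-adjoint under the similitude `g B′ gᵀ = λ B`. -/
theorem transported_Q_selfAdjoint (lam : k) (hlam : lam ≠ 0)
    (hiso : g * (PlaneData.ofLinesRow q a' b' ε').B * gᵀ = lam • (PlaneData.ofLinesRow q a b ε).B) (j : Fin 2) :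
    ((PlaneData.ofLinesRow q a b ε).withTransportedTorus g g' hgg' hg'g hgΩ).Q j *
        ((PlaneData.ofLinesRow q a b ε).withTransportedTorus g g' hgg' hg'g hgΩ).B =
      ((PlaneData.ofLinesRow q a b ε).withTransportedTorus g g' hgg' hg'g hgΩ).B *
        (((PlaneData.ofLinesRow q a b ε).withTransportedTorus g g' hgg' hg'g hgΩ).Q j)ᵀ := by
  have hB' := B'_eq_of_similitude q a b ε a' b' ε' g g' hgg' hg'g lam hiso
  have hiso' : g' * (PlaneData.ofLinesRow q a b ε).B * g'ᵀ = lam⁻¹ • (PlaneData.ofLinesRow q a' b' ε').B := by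
    rw [hB', smul_smul, inv_mul_cancel₀ hlam, one_smul]
  have hP : (PlaneData.ofLinesRow q a' b' ε').P j * (PlaneData.ofLinesRow q a' b' ε').B =
      (PlaneData.ofLinesRow q a' b' ε').B * ((PlaneData.ofLinesRow q a' b' ε').P j)ᵀ :=
    ofLinesRow_P_mul_B q a' b' ε' j
  have h := transported_selfAdjoint (PlaneData.ofLinesRow q a b ε).B (PlaneData.ofLinesRow q a' b' ε').B
    ((PlaneData.ofLinesRow q a' b' ε').P j) g' g hg'g hgg' lam⁻¹ hiso' hP
  exact h

end Fibre

section Coords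

variable {k : Type} [Field k] [NumberField k] (q : QuadData k) (a b ε : k)
  (g g' : Matrix (Fin 4) (Fin 4) k) (hgg' : g * g' = 1) (hg'g : g' * g = 1)
  (hgΩ : g * (PlaneData.ofLinesRow q a b ε).Ω = (PlaneData.ofLinesRow q a b ε).Ω * g)

omit [NumberField k] in
/-- **The four block scalars of a rational point in the row model**: with `w = ![e₀, e₂]` and `v j = w j g'`,
`(w i m) Q j = v j · escK (x i j) (y i j)` for `x i j = (m g) (2i) (2j)`, `y i j = (m g) (2i+1) (2j)`. -/
theorem row_coords_block {m : Matrix (Fin 4) (Fin 4) k}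
    (hmΩ : m * (PlaneData.ofLinesRow q a b ε).Ω = (PlaneData.ofLinesRow q a b ε).Ω * m) (i j : Fin 2) :
    ((![Pi.single 0 1, Pi.single 2 1] : Fin 2 → Fin 4 → k) i ᵥ* m) ᵥ*
        ((PlaneData.ofLinesRow q a b ε).withTransportedTorus g g' hgg' hg'g hgΩ).Q j
      = ((![Pi.single 0 1, Pi.single 2 1] : Fin 2 → Fin 4 → k) j ᵥ* g') ᵥ*
        escK ((PlaneData.ofLinesRow q a b ε).withTransportedTorus g g' hgg' hg'g hgΩ)
          ((m * g) (![0, 2] i) (![0, 2] j)) ((m * g) (![1, 3] i) (![0, 2] j)) := by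
  have hMΩ : (m * g) * (PlaneData.ofLinesRow q a b ε).Ω = (PlaneData.ofLinesRow q a b ε).Ω * (m * g) := by
    rw [Matrix.mul_assoc, hgΩ, ← Matrix.mul_assoc, hmΩ, Matrix.mul_assoc]
  have hg'Ω := g'_comm_Ω q a b ε g g' hgg' hg'g hgΩ
  have hQ : ((PlaneData.ofLinesRow q a b ε).withTransportedTorus g g' hgg' hg'g hgΩ).Q j =
      g * (PlaneData.ofLinesRow q a b ε).P j * g' := rfl
  have hΩ : ((PlaneData.ofLinesRow q a b ε).withTransportedTorus g g' hgg' hg'g hgΩ).Ω =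
      (PlaneData.ofLinesRow q a b ε).Ω := rfl
  set M := m * g with hM
  set x := M (![0, 2] i) (![0, 2] j) with hx
  set y := M (![1, 3] i) (![0, 2] j) with hy
  set E := x • (1 : Matrix (Fin 4) (Fin 4) k) + y • (PlaneData.ofLinesRow q a b ε).Ω with hE
  have hcomm : g' * E = E * g' := by
    rw [hE, Matrix.mul_add, Matrix.add_mul, Matrix.mul_smul, Matrix.smul_mul, Matrix.mul_smul, Matrix.smul_mul,
      Matrix.mul_one, Matrix.one_mul, hg'Ω]
  have key : (![Pi.single 0 1, Pi.single 2 1] : Fin 2 → Fin 4 → k) i ᵥ* (M * (PlaneData.ofLinesRow q a b ε).P j) =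
      (![Pi.single 0 1, Pi.single 2 1] : Fin 2 → Fin 4 → k) j ᵥ* E := by
    rw [ofLinesRow_Ω_eq_blockDiag4R] at hMΩ
    obtain ⟨h01, h03, h21, h23⟩ := entries_of_comm hMΩ
    have hP0 : (PlaneData.ofLinesRow q a b ε).P 0 = blockDiag4R 1 0 := rfl
    have hP1 : (PlaneData.ofLinesRow q a b ε).P 1 = blockDiag4R 0 1 := rfl
    rw [hE, ofLinesRow_Ω_eq_blockDiag4R, blockDiag4R_omegaMatR_eq]
    fin_cases i <;> fin_cases j <;>
      simp only [Fin.zero_eta, Fin.isValue, Fin.mk_one, Matrix.cons_val_zero, Matrix.cons_val_one,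
        hP0, hP1, blockDiag4R_one_zero_eq, blockDiag4R_zero_one_eq,
        Matrix.single_one_vecMul] <;>
      ext l <;> fin_cases l <;>
      simp [Matrix.row, Matrix.mul_apply, Fin.sum_univ_four, h01, h03, h21, h23, hx, hy, mul_comm]
  have hE' : escK ((PlaneData.ofLinesRow q a b ε).withTransportedTorus g g' hgg' hg'g hgΩ) x y = E := by
    rw [escK, hΩ]
  rw [hE', hQ]
  calc ((![Pi.single 0 1, Pi.single 2 1] : Fin 2 → Fin 4 → k) i ᵥ* m) ᵥ*
        (g * (PlaneData.ofLinesRow q a b ε).P j * g')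
      = (![Pi.single 0 1, Pi.single 2 1] : Fin 2 → Fin 4 → k) i ᵥ*
          (M * (PlaneData.ofLinesRow q a b ε).P j * g') := by
        rw [Matrix.vecMul_vecMul, hM]
        simp only [Matrix.mul_assoc]
    _ = ((![Pi.single 0 1, Pi.single 2 1] : Fin 2 → Fin 4 → k) i ᵥ*
          (M * (PlaneData.ofLinesRow q a b ε).P j)) ᵥ* g' := by
        rw [Matrix.vecMul_vecMul]
    _ = ((![Pi.single 0 1, Pi.single 2 1] : Fin 2 → Fin 4 → k) j ᵥ* E) ᵥ* g' := by rw [key]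
    _ = (![Pi.single 0 1, Pi.single 2 1] : Fin 2 → Fin 4 → k) j ᵥ* (E * g') := by rw [Matrix.vecMul_vecMul]
    _ = (![Pi.single 0 1, Pi.single 2 1] : Fin 2 → Fin 4 → k) j ᵥ* (g' * E) := by rw [hcomm]
    _ = ((![Pi.single 0 1, Pi.single 2 1] : Fin 2 → Fin 4 → k) j ᵥ* g') ᵥ* E := by rw [Matrix.vecMul_vecMul]

end Coords

section Main

open MeasureTheory

variable {k : Type} [Field k] [NumberField k] (q : QuadData k) (a b ε a' b' ε' : k)
  (g g' : Matrix (Fin 4) (Fin 4) k) (hgg' : g * g' = 1) (hg'g : g' * g = 1)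
  (hgΩ : g * (PlaneData.ofLinesRow q a b ε).Ω = (PlaneData.ofLinesRow q a b ε).Ω * g)

include hgg' hg'g in
/-- The rows `e₀ g'`, `e₂ g'` are `B`-anisotropic under the similitude (`a', b', ε', n ≠ 0`). -/
theorem form_row_g'_ne_zero (ht : q.t = 0) (hn : q.n ≠ 0) (ha' : a' ≠ 0) (hb' : b' ≠ 0) (hε' : ε' ≠ 0)
    (lam : k) (hlam : lam ≠ 0)
    (hiso : g * (PlaneData.ofLinesRow q a' b' ε').B * gᵀ = lam • (PlaneData.ofLinesRow q a b ε).B) (j : Fin 2) :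
    ((![Pi.single 0 1, Pi.single 2 1] : Fin 2 → Fin 4 → k) j ᵥ* g') ᵥ* (PlaneData.ofLinesRow q a b ε).B ⬝ᵥ
      ((![Pi.single 0 1, Pi.single 2 1] : Fin 2 → Fin 4 → k) j ᵥ* g') ≠ 0 := by
  have hB' := B'_eq_of_similitude q a b ε a' b' ε' g g' hgg' hg'g lam hiso
  have hiso' : g' * (PlaneData.ofLinesRow q a b ε).B * g'ᵀ = lam⁻¹ • (PlaneData.ofLinesRow q a' b' ε').B := by
    rw [hB', smul_smul, inv_mul_cancel₀ hlam, one_smul]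
  have hform : ∀ u : Fin 4 → k, (u ᵥ* g') ᵥ* (PlaneData.ofLinesRow q a b ε).B ⬝ᵥ (u ᵥ* g') =
      lam⁻¹ * (u ᵥ* (PlaneData.ofLinesRow q a' b' ε').B ⬝ᵥ u) := by
    intro u
    have h1 : (u ᵥ* g') ᵥ* (PlaneData.ofLinesRow q a b ε).B ⬝ᵥ (u ᵥ* g') =
        u ᵥ* (g' * (PlaneData.ofLinesRow q a b ε).B * g'ᵀ) ⬝ᵥ u := by
      rw [Matrix.vecMul_vecMul]
      conv_rhs => rw [← Matrix.vecMul_vecMul, ← Matrix.dotProduct_mulVec, Matrix.mulVec_transpose]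
    rw [h1, hiso', Matrix.vecMul_smul, smul_dotProduct, smul_eq_mul]
  rw [hform]
  refine mul_ne_zero (inv_ne_zero hlam) ?_
  have hB := ofLinesRow_B_eq q a' b' ε' ht
  fin_cases j <;> simp [hB, Matrix.vecMul, dotProduct, Fin.sum_univ_four, ha', hb', hε', hn]

/-- The injectivity of the principal embedding `k → 𝔸_k` (through the archimedean part). -/
theorem algebraMap_Ad_injective : Function.Injective (algebraMap k (Ad k)) := by
  intro x y h
  have h' := congrArg (infPart k) h
  rw [infPart_algebraMap, infPart_algebraMap] at h'
  exact algebraMap_infiniteAdeleRing_injective h'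

variable (W : PlaneData k) (hW : W = (PlaneData.ofLinesRow q a b ε).withTransportedTorus g g' hgg' hg'g hgΩ)
  [MeasurableSpace (GA W)] [BorelSpace (GA W)] (R : RTFData W) (μ : Measure (GA W))
  [μ.IsHaarMeasure] [R.μT.IsHaarMeasure] [R.μT'.IsHaarMeasure] (DG : Set (GA W))
  (fdG : IsFundamentalDomain (rationalPoints W) DG μ) (compG : IsCompact (closure DG))
  (compT : IsCompact (closure R.DT)) (compT' : IsCompact (closure R.DT'))

include hW in
/-- **THE FIBRE OF THE ORBIT INVARIANT ON THE REGULAR LOCUS HAS ONE ELEMENT**: on the transported row plane with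
`t = 0`, `¬ IsSquare (−n)`, and the similitude `g B′ gᵀ = λ B`, two rational points `γ, γ'` whose four block scalars
are non-zero (`hreg`, `hreg'`: the regular locus, in the coordinates `x i j = (m g) (2i) (2j)`,
`y i j = (m g) (2i+1) (2j)` of their `k`-matrices) and with `orbitInv W g γ = orbitInv W g γ'` lie in the same orbit
of the Setting `Setting.ofAdelicData W R μ DG fdG compG compT compT'`. -/
theorem orbitOf_eq_of_orbitInv_eq (ht : q.t = 0) (hn : q.n ≠ 0) (hd : ¬ IsSquare (-q.n))
    (ha : a ≠ 0) (hb : b ≠ 0) (hε : ε ≠ 0) (ha' : a' ≠ 0) (hb' : b' ≠ 0) (hε' : ε' ≠ 0) (lam : k) (hlam : lam ≠ 0)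
    (hiso : g * (PlaneData.ofLinesRow q a' b' ε').B * gᵀ = lam • (PlaneData.ofLinesRow q a b ε).B)
    {γ γ' : (Setting.ofAdelicData W R μ DG fdG compG compT compT').Gk}
    {m m' : Matrix (Fin 4) (Fin 4) k}
    (hm : GA.mat W (γ : GA W) = m.map (algebraMap k (Ad k)))
    (hm' : GA.mat W (γ' : GA W) = m'.map (algebraMap k (Ad k)))
    (hreg : ∀ i j : Fin 2, ¬ ((m * g) (![0, 2] i) (![0, 2] j) = 0 ∧ (m * g) (![1, 3] i) (![0, 2] j) = 0))
    (hreg' : ∀ i j : Fin 2, ¬ ((m' * g) (![0, 2] i) (![0, 2] j) = 0 ∧ (m' * g) (![1, 3] i) (![0, 2] j) = 0))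
    (hinv : orbitInv W g (γ : GA W) = orbitInv W g (γ' : GA W)) :
    (Setting.ofAdelicData W R μ DG fdG compG compT compT').orbitOf γ =
      (Setting.ofAdelicData W R μ DG fdG compG compT compT').orbitOf γ' := by
  subst hW
  -- the plane data
  have hq : q.t ^ 2 - 4 * q.n ≠ 0 := by
    have h4 : (4 : k) ≠ 0 := by norm_num
    rw [ht, zero_pow two_ne_zero, zero_sub, neg_ne_zero]
    exact mul_ne_zero h4 hn
  have hΩ : ((PlaneData.ofLinesRow q a b ε).withTransportedTorus g g' hgg' hg'g hgΩ).Ω *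
      ((PlaneData.ofLinesRow q a b ε).withTransportedTorus g g' hgg' hg'g hgΩ).Ω =
      -(q.n • (1 : Matrix (Fin 4) (Fin 4) k)) := ofLinesRow_Ω_sq q a b ε ht
  have hΩB : ((PlaneData.ofLinesRow q a b ε).withTransportedTorus g g' hgg' hg'g hgΩ).Ω *
      ((PlaneData.ofLinesRow q a b ε).withTransportedTorus g g' hgg' hg'g hgΩ).B =
      -(((PlaneData.ofLinesRow q a b ε).withTransportedTorus g g' hgg' hg'g hgΩ).B *
        ((PlaneData.ofLinesRow q a b ε).withTransportedTorus g g' hgg' hg'g hgΩ).Ωᵀ) := by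
    have h := IsHermitianPlaneRow.omega_mul_B_of_t_eq_zero q (ofLinesRow_isHermitianRow q a b ε ha hb hε hq) ht
    exact h
  have hPB : ∀ i, ((PlaneData.ofLinesRow q a b ε).withTransportedTorus g g' hgg' hg'g hgΩ).P i *
      ((PlaneData.ofLinesRow q a b ε).withTransportedTorus g g' hgg' hg'g hgΩ).B =
      ((PlaneData.ofLinesRow q a b ε).withTransportedTorus g g' hgg' hg'g hgΩ).B *
        (((PlaneData.ofLinesRow q a b ε).withTransportedTorus g g' hgg' hg'g hgΩ).P i)ᵀ :=
    fun i => ofLinesRow_P_mul_B q a b ε i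
  have hQB := transported_Q_selfAdjoint q a b ε a' b' ε' g g' hgg' hg'g hgΩ lam hlam hiso
  -- the rows
  have hP0 : (PlaneData.ofLinesRow q a b ε).P 0 = blockDiag4R 1 0 := rfl
  have hP1 : (PlaneData.ofLinesRow q a b ε).P 1 = blockDiag4R 0 1 := rfl
  have hw : ∀ i, (![Pi.single 0 1, Pi.single 2 1] : Fin 2 → Fin 4 → k) i ᵥ*
      (PlaneData.ofLinesRow q a b ε).P i = (![Pi.single 0 1, Pi.single 2 1] : Fin 2 → Fin 4 → k) i := by
    intro i
    fin_cases i
    · show (Pi.single 0 1 : Fin 4 → k) ᵥ* (PlaneData.ofLinesRow q a b ε).P 0 = Pi.single 0 1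
      rw [hP0, blockDiag4R_one_zero_eq]
      ext l
      fin_cases l <;> simp [Matrix.vecMul, dotProduct, Fin.sum_univ_four]
    · show (Pi.single 2 1 : Fin 4 → k) ᵥ* (PlaneData.ofLinesRow q a b ε).P 1 = Pi.single 2 1
      rw [hP1, blockDiag4R_zero_one_eq]
      ext l
      fin_cases l <;> simp [Matrix.vecMul, dotProduct, Fin.sum_univ_four]
  have hw0 : ∀ i, (![Pi.single 0 1, Pi.single 2 1] : Fin 2 → Fin 4 → k) i ≠ 0 := by
    intro i
    fin_cases i
    · simp
    · simp
  have hv : ∀ j, ((![Pi.single 0 1, Pi.single 2 1] : Fin 2 → Fin 4 → k) j ᵥ* g') ᵥ*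
      ((PlaneData.ofLinesRow q a b ε).withTransportedTorus g g' hgg' hg'g hgΩ).Q j =
      (![Pi.single 0 1, Pi.single 2 1] : Fin 2 → Fin 4 → k) j ᵥ* g' := by
    intro j
    have hQ : ((PlaneData.ofLinesRow q a b ε).withTransportedTorus g g' hgg' hg'g hgΩ).Q j =
        g * (PlaneData.ofLinesRow q a b ε).P j * g' := rfl
    rw [hQ, Matrix.vecMul_vecMul, ← Matrix.mul_assoc, ← Matrix.mul_assoc, hg'g, Matrix.one_mul,
      ← Matrix.vecMul_vecMul]
    have := hw j
    rw [this]
  have ha0 : (![Pi.single 0 1, Pi.single 2 1] : Fin 2 → Fin 4 → k) 0 ᵥ*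
      ((PlaneData.ofLinesRow q a b ε).withTransportedTorus g g' hgg' hg'g hgΩ).B ⬝ᵥ
      (![Pi.single 0 1, Pi.single 2 1] : Fin 2 → Fin 4 → k) 0 ≠ 0 := by
    show (Pi.single 0 1 : Fin 4 → k) ᵥ* (PlaneData.ofLinesRow q a b ε).B ⬝ᵥ (Pi.single 0 1 : Fin 4 → k) ≠ 0
    rw [ofLinesRow_B_eq q a b ε ht]
    simp [Matrix.vecMul, dotProduct, Fin.sum_univ_four, ha, hn]
  have hbj : ∀ j, ((![Pi.single 0 1, Pi.single 2 1] : Fin 2 → Fin 4 → k) j ᵥ* g') ᵥ*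
      ((PlaneData.ofLinesRow q a b ε).withTransportedTorus g g' hgg' hg'g hgΩ).B ⬝ᵥ
      ((![Pi.single 0 1, Pi.single 2 1] : Fin 2 → Fin 4 → k) j ᵥ* g') ≠ 0 :=
    fun j => form_row_g'_ne_zero q a b ε a' b' ε' g g' hgg' hg'g ht hn ha' hb' hε' lam hlam hiso j
  -- the block scalars
  obtain ⟨hmΩ, -⟩ := rational_mat_props _ hm.symm
  obtain ⟨hmΩ', -⟩ := rational_mat_props _ hm'.symm
  have hxy := row_coords_block q a b ε g g' hgg' hg'g hgΩ hmΩ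
  have hxy' := row_coords_block q a b ε g g' hgg' hg'g hgΩ hmΩ'
  -- the (0,0) norms agree
  have hK : orbitInvK g m = orbitInvK g m' := by
    apply algebraMap_Ad_injective
    rw [← orbitInv_eq_algebraMap _ g hm, ← orbitInv_eq_algebraMap _ g hm', hinv]
  have h00 : nrmK q.n ((m' * g) (![0, 2] 0) (![0, 2] 0)) ((m' * g) (![1, 3] 0) (![0, 2] 0)) =
      nrmK q.n ((m * g) (![0, 2] 0) (![0, 2] 0)) ((m * g) (![1, 3] 0) (![0, 2] 0)) := by
    simp only [Matrix.cons_val_zero]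
    rw [← orbitInvK_eq_nrmK q a b ε g hgΩ ht hmΩ, ← orbitInvK_eq_nrmK q a b ε g hgΩ ht hmΩ', hK]
  exact orbitOf_eq_of_scalar_nrm_eq _ R μ DG fdG compG compT compT' hΩ hd hΩB hPB hQB hw hw0 hv ha0 hbj
    hm.symm hm'.symm hxy hxy' hreg hreg' h00

include hW in
/-- **OFF THE ORBIT, OFF THE FIBRE** (the `hne` binder with `E = {o₀}` on the regular locus): if the orbit of `γ` is not
the orbit of `γ₀`, their invariants differ. -/
theorem orbitInv_ne_of_orbitOf_ne (ht : q.t = 0) (hn : q.n ≠ 0) (hd : ¬ IsSquare (-q.n))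
    (ha : a ≠ 0) (hb : b ≠ 0) (hε : ε ≠ 0) (ha' : a' ≠ 0) (hb' : b' ≠ 0) (hε' : ε' ≠ 0) (lam : k) (hlam : lam ≠ 0)
    (hiso : g * (PlaneData.ofLinesRow q a' b' ε').B * gᵀ = lam • (PlaneData.ofLinesRow q a b ε).B)
    {γ γ₀ : (Setting.ofAdelicData W R μ DG fdG compG compT compT').Gk}
    {m m₀ : Matrix (Fin 4) (Fin 4) k}
    (hm : GA.mat W (γ : GA W) = m.map (algebraMap k (Ad k)))
    (hm₀ : GA.mat W (γ₀ : GA W) = m₀.map (algebraMap k (Ad k)))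
    (hreg : ∀ i j : Fin 2, ¬ ((m * g) (![0, 2] i) (![0, 2] j) = 0 ∧ (m * g) (![1, 3] i) (![0, 2] j) = 0))
    (hreg₀ : ∀ i j : Fin 2, ¬ ((m₀ * g) (![0, 2] i) (![0, 2] j) = 0 ∧ (m₀ * g) (![1, 3] i) (![0, 2] j) = 0))
    (hne : (Setting.ofAdelicData W R μ DG fdG compG compT compT').orbitOf γ ≠
      (Setting.ofAdelicData W R μ DG fdG compG compT compT').orbitOf γ₀) :
    orbitInv W g (γ : GA W) ≠ orbitInv W g (γ₀ : GA W) :=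
  fun h => hne (orbitOf_eq_of_orbitInv_eq q a b ε a' b' ε' g g' hgg' hg'g hgΩ W hW R μ DG fdG compG compT compT'
    ht hn hd ha hb hε ha' hb' hε' lam hlam hiso hm hm₀ hreg hreg₀ h)

end Main

end

end Summit.Ventures.HodgeRepro.Tier4.Line4
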